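import Mathlib
import HarnessLib
import Summits.HubbardSuperconductivity.HubbardSuperconductivity.Theorems.KLProgrammeKLRegimeSplitPairLadderV4

/-!
# Route `KLProgramme` — row 0′ of the K3 supplier map, pair-class ladder part, GENERIC in the per-step extra remainder

Cell gate-hubbard-kl, seat hubbard-kl-r2d-p1 (child `KLRegimeBetaSplit`).  `pairLadder_envelope_v4` (`…SplitPairLadderV4`) hard-wires the V4 extra
term `thermalBar + legDressBar`; the leg majorant has since been restaged (Δ15, `legDressBarQ`, plan g10 14:03Z) and may move again.  So the
ladder is proved here ONCE for an ARBITRARY nonnegative per-step extra term `X j k k'` with a per-entry scale-sum bound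
`Σ_{i<n} X (i+1) k k' ≤ Xtot` and a per-scale bound `X (i+1) k k' ≤ Xsup`, and for ABSTRACT step data (weights, right inverse, remainder
`(drivePBar i + ē_i) + X (i+1) k k'`), fed to `sWaveCascade_envelope_sources` exactly as in the V4 file: **`pairLadder_envelope_extra`** —
`∃ u ∈ [0,U]`, `|𝒞_n(k,k') − u| ≤ 8·((initDevBar + Σ_{j<n}(drivePBar+ē) + Xtot) + (Σ_{j<n}(drivePBar+ē) + Xsup))` under the smallness
`8·20·(…)·bhi·n ≤ 1`.  The V5 instance (⇒ `PairArrayAtV2`) is `…SplitPairArrayV5`.  Everything is proved; no definitions.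
-/

noncomputable section

namespace Summit.HubbardSuperconductivity.HubbardSuperconductivity.Theorems.KLRegimeSplit

set_option linter.dupNamespace false -- summit = problem name (single-conjunct summit), D-0017

open Finset Literature.MathematicalPhysics.QuantumLattice Literature.Probability.LatticeModels
open Summit.HubbardSuperconductivity.HubbardSuperconductivity.Theorems.KLProgrammeLegKernels
open Summit.HubbardSuperconductivity.HubbardSuperconductivity.Theorems.CooperChannelRiccatiFlow
open Summit.HubbardSuperconductivity.HubbardSuperconductivity.Theorems.SWaveCascade

section Model

variable (L M : ℕ) [NeZero L] [NeZero M]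

variable {G : GeoConsts} {P : SplitConsts} {Qc : EngConsts}

/-- **Row 0′, pair-class ladder part, GENERIC in the per-step extra remainder.**  Steps `i → i+1` (`i < n`) with weights `w_i ≥ 0` of mass
`≤ bhi`, a right inverse `N_i` of `1 + diag(w_i)·𝒞_i`, and `|𝒞_{i+1}(k,k') − (𝒞_i N_i)(k,k')| ≤ (drivePBar i + ē_i) + X (i+1) k k'` on the ball,
where `X ≥ 0` has the per-entry scale sum `Σ_{i<n} X (i+1) k k' ≤ Xtot` and the per-scale size `X (i+1) k k' ≤ Xsup`; initial data
`|𝒞_0 − U| ≤ initDevBar`; smallness `8·20·((initDevBar + Σ_{j<n}(drivePBar+ē) + Xtot) + (Σ_{j<n}(drivePBar+ē) + Xsup))·bhi·n ≤ 1`.  THEN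
`∃ u ∈ [0, U]` with `|𝒞_n(k,k') − u| ≤ 8·((initDevBar + Σ + Xtot) + (Σ + Xsup))` on the ball. -/
theorem pairLadder_envelope_extra (hG : G.WF) (hP : P.WF) (hQc : Qc.WF) {β U μ : ℝ} {K : TrigPolyC4v} (hU : 0 ≤ U) {n : ℕ}
    {Qm : TorusSite 2 L} (X : ℕ → TorusSite 2 L → TorusSite 2 L → ℝ) {Xtot Xsup : ℝ} (hX0 : ∀ j k k', 0 ≤ X j k k')
    (hXsup : ∀ i < n, ∀ k k', X (i + 1) k k' ≤ Xsup) (hXtot : ∀ k k', ∑ i ∈ range n, X (i + 1) k k' ≤ Xtot)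
    (hXtot0 : 0 ≤ Xtot) (hXsup0 : 0 ≤ Xsup)
    (h0 : ∀ k ∈ klBall L μ K, ∀ k' ∈ klBall L μ K, ‖klPairAmplitude L M β U μ K 0 Qm k k' - (U : ℂ)‖ ≤ initDevBar G U)
    (hsteps : ∀ i < n, ∃ w : TorusSite 2 L → ℝ, (∀ p, 0 ≤ w p) ∧ (∑ p, w p ≤ G.bhi) ∧
      ∃ N : Matrix (TorusSite 2 L) (TorusSite 2 L) ℂ,
        (1 + Matrix.diagonal (fun p => (w p : ℂ)) * klPairArray L M β U μ K i Qm) * N = 1 ∧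
        ∀ k ∈ klBall L μ K, ∀ k' ∈ klBall L μ K,
          ‖klPairAmplitude L M β U μ K (i + 1) Qm k k' - (klPairArray L M β U μ K i Qm * N) k k'‖ ≤
            (drivePBar G P U i + eremBar G P Qc U β L i) + X (i + 1) k k')
    (hsmall : 8 * 20 * ((initDevBar G U + ∑ j ∈ range n, (drivePBar G P U j + eremBar G P Qc U β L j) + Xtot) +
        (∑ j ∈ range n, (drivePBar G P U j + eremBar G P Qc U β L j) + Xsup)) * (G.bhi * n) ≤ 1) :
    ∃ u : ℝ, 0 ≤ u ∧ u ≤ U ∧ ∀ k ∈ klBall L μ K, ∀ k' ∈ klBall L μ K,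
      ‖klPairAmplitude L M β U μ K n Qm k k' - (u : ℂ)‖ ≤
        8 * ((initDevBar G U + ∑ j ∈ range n, (drivePBar G P U j + eremBar G P Qc U β L j) + Xtot) +
          (∑ j ∈ range n, (drivePBar G P U j + eremBar G P Qc U β L j) + Xsup)) := by
  classical
  -- notation
  set B : Finset (TorusSite 2 L) := klBall L μ K with hB
  set τ : ℕ → ℝ := fun j => drivePBar G P U j + eremBar G P Qc U β L j with hτ
  have hτ0 : ∀ j, 0 ≤ τ j := fun j => add_nonneg (drivePBar_nonneg' hG U j) (eremBar_nonneg' hG hP hQc U β L j)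
  set Sτ : ℝ := ∑ j ∈ range n, τ j with hSτ
  have hSτ0 : 0 ≤ Sτ := sum_nonneg fun j _ => hτ0 j
  have hτle : ∀ i < n, τ i ≤ Sτ := fun i hi =>
    single_le_sum (f := τ) (fun j _ => hτ0 j) (mem_range.2 hi)
  set A : ℝ := initDevBar G U + Sτ + Xtot with hA
  set R : ℝ := Sτ + Xsup with hR
  have hbhi : 0 ≤ G.bhi := hG.2.2.1.trans hG.2.2.2.1
  have hinit0 : 0 ≤ initDevBar G U := by
    unfold initDevBar
    refine mul_nonneg (add_nonneg (sum_nonneg fun χ _ => add_nonneg (hG.2.1 χ) (hG.1 χ)) zero_le_one) (sq_nonneg U)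
  have hA0 : 0 ≤ A := by positivity
  set C : ℕ → Matrix (TorusSite 2 L) (TorusSite 2 L) ℂ := fun i => klPairArray L M β U μ K i Qm with hC
  have hCsupp : ∀ i u, u ∉ B → ∀ t, C i u t = 0 := fun i u hu t => klPairArray_apply_of_not_mem L M β U μ K i Qm hu t
  -- the step data
  choose! wt hwt0 hwtsum Nm hNm happ using hsteps
  -- the matrices Δ, T and the full-carrier implicit step
  set Δ : ℕ → Matrix (TorusSite 2 L) (TorusSite 2 L) ℂ := fun i => C (i + 1) - C i * Nm i with hΔ
  set T : ℕ → Matrix (TorusSite 2 L) (TorusSite 2 L) ℂ :=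
    fun i => Δ i + Δ i * Matrix.diagonal (fun p => (wt i p : ℂ)) * C i with hT
  have hfull : ∀ i < n, C (i + 1) = C i - C (i + 1) * Matrix.diagonal (fun p => (wt i p : ℂ)) * C i + T i :=
    fun i hi => implicit_step_of_rightInverse (wt i) (hNm i hi) (by simp only [hΔ]; abel)
  -- restriction to the ball
  set 𝒞r : ℕ → ↥B → ↥B → ℂ := fun i => resArr B (C i) with h𝒞r
  set wr : ℕ → ↥B → ℝ := fun i u => if i < n then wt i u.1 else 0 with hwr
  set Δr : ℕ → ↥B → ↥B → ℂ := fun i => resArr B (Δ i) with hΔr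
  have hwr_eq : ∀ i < n, wr i = fun u : ↥B => wt i u.1 := fun i hi => funext fun u => if_pos hi
  have hwr0 : ∀ i u, 0 ≤ wr i u := by
    intro i u
    by_cases hi : i < n
    · rw [hwr_eq i hi]; exact hwt0 i hi u.1
    · simp [hwr, hi]
  have hWr : ∀ i < n, ∑ u, wr i u ≤ G.bhi := fun i hi => by
    rw [hwr_eq i hi]
    calc ∑ u : ↥B, wt i u.1 = ∑ u ∈ B, wt i u := Finset.sum_coe_sort B (wt i)
      _ ≤ ∑ u, wt i u := sum_le_sum_of_subset_of_nonneg (subset_univ B) fun u _ _ => hwt0 i hi u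
      _ ≤ G.bhi := hwtsum i hi
  have hWr0 : ∀ i, 0 ≤ ∑ u, wr i u := fun i => sum_nonneg fun u _ => hwr0 i u
  have hTr_eq : ∀ i < n, resArr B (T i) = Δr i + wmul (wr i) (Δr i) (𝒞r i) := by
    intro i hi
    funext k k'
    have hw := congrFun (congrFun (resArr_wmul B (wt i) (Δ i) (C i) (hCsupp i)) k) k'
    rw [← hwr_eq i hi] at hw
    simp only [resArr] at hw
    simp only [hT, h𝒞r, hΔr, Pi.add_apply, resArr, Matrix.add_apply, mul_diagonal_mul_apply_eq_wmul, hw]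
  have hstepr : ∀ i < n, 𝒞r (i + 1) = 𝒞r i - wmul (wr i) (𝒞r (i + 1)) (𝒞r i) + resArr B (T i) := by
    intro i hi
    funext k k'
    have h := congrFun (congrFun (hfull i hi) k.1) k'.1
    have hw := congrFun (congrFun (resArr_wmul B (wt i) (C (i + 1)) (C i) (hCsupp i)) k) k'
    rw [← hwr_eq i hi] at hw
    simp only [resArr] at hw
    rw [Matrix.add_apply, Matrix.sub_apply, mul_diagonal_mul_apply_eq_wmul, hw] at h
    simp only [h𝒞r, Pi.add_apply, Pi.sub_apply, resArr]
    exact h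
  -- the repulsive scalar cascade on the ball
  obtain ⟨Us, hUs0, hUss⟩ : ∃ Us : ℕ → ℝ, Us 0 = U ∧ ∀ i, Us (i + 1) = Us i / (1 + (∑ u, wr i u) * Us i) :=
    ⟨fun i => Nat.rec U (fun i u => u / (1 + (∑ v, wr i v) * u)) i, rfl, fun i => rfl⟩
  have hUs0' : 0 ≤ Us 0 := by rw [hUs0]; exact hU
  have hUss' : ∀ i, Us (i + 1) = Us i / (1 + (∑ u, wr i u) * 1 * Us i) := fun i => by rw [hUss i, mul_one]
  have hUs_nonneg : ∀ i, 0 ≤ Us i :=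
    sWave_nonneg (U := Us) (W := 1) (b := fun i => ∑ u, wr i u) zero_le_one hWr0 hUs0' hUss'
  -- the split of the tail: core + column source
  set 𝒟r : ℕ → ↥B → ↥B → ℂ := fun i => 𝒞r i - ((Us i : ℝ) : ℂ) • onesArr with h𝒟r
  set Er : ℕ → ↥B → ↥B → ℂ := fun i => Δr i + wmul (wr i) (Δr i) (𝒟r i) with hEr
  set cr : ℕ → ↥B → ℂ := fun i s => ((Us i : ℝ) : ℂ) * ∑ u, Δr i s u * (wr i u : ℂ) with hcr
  have hsplit : ∀ i < n, resArr B (T i) = Er i + fun s _ => cr i s := by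
    intro i hi
    rw [hTr_eq i hi]
    have h𝒞 : 𝒞r i = ((Us i : ℝ) : ℂ) • onesArr + 𝒟r i := by simp only [h𝒟r]; abel
    funext s t
    simp only [hEr, hcr, Pi.add_apply]
    conv_lhs => rw [h𝒞]
    rw [wmul_add_right, wmul_smul_right]
    simp only [Pi.add_apply, Pi.smul_apply, smul_eq_mul, wmul_onesArr_right_eq]
    ring
  have hstep' : ∀ i < n, 𝒞r (i + 1) = 𝒞r i - wmul (wr i) (𝒞r (i + 1)) (𝒞r i) + (Er i + fun s _ => cr i s) := by
    intro i hi
    have h := hstepr i hi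
    rw [hsplit i hi] at h
    exact h
  -- the entrywise majorant of the remainder
  set e : ℕ → ↥B → ↥B → ℝ := fun i s t => τ i + X (i + 1) s.1 t.1 with he
  have he0 : ∀ i s t, 0 ≤ e i s t := fun i s t => add_nonneg (hτ0 i) (hX0 _ _ _)
  have hΔr_le : ∀ i < n, ∀ s t : ↥B, ‖Δr i s t‖ ≤ e i s t := by
    intro i hi s t
    have := happ i hi s.1 s.2 t.1 t.2
    simpa [hΔr, hΔ, hC, resArr, klPairArray_apply_of_mem L M β U μ K (i + 1) Qm s.2 t.2, Matrix.sub_apply, he] using this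
  have he_le_R : ∀ i < n, ∀ s t : ↥B, e i s t ≤ R := by
    intro i hi s t
    have h1 := hτle i hi
    have h2 := hXsup i hi s.1 t.1
    simp only [he, hR] at *
    linarith
  have hR0 : 0 ≤ R := by positivity
  have hΔr_sup : ∀ i < n, esup (Δr i) ≤ R := fun i hi =>
    esup_le (fun s t => (hΔr_le i hi s t).trans (he_le_R i hi s t)) hR0
  -- hypotheses of the cascade lemma
  have hE : ∀ i < n, ∀ s t, ‖Er i s t‖ ≤ e i s t + R * (∑ u, wr i u) * esup (𝒞r i - ((Us i : ℝ) : ℂ) • onesArr) := by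
    intro i hi s t
    have h1 := hΔr_le i hi s t
    have h2 : ‖wmul (wr i) (Δr i) (𝒟r i) s t‖ ≤ esup (Δr i) * (∑ u, wr i u) * esup (𝒟r i) :=
      (le_esup _ s t).trans (esup_wmul_le (wr i) (hwr0 i) _ _)
    have h3 : esup (Δr i) * (∑ u, wr i u) * esup (𝒟r i) ≤ R * (∑ u, wr i u) * esup (𝒟r i) :=
      mul_le_mul_of_nonneg_right (mul_le_mul_of_nonneg_right (hΔr_sup i hi) (hWr0 i)) (esup_nonneg _)
    calc ‖Er i s t‖ = ‖Δr i s t + wmul (wr i) (Δr i) (𝒟r i) s t‖ := rfl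
      _ ≤ ‖Δr i s t‖ + ‖wmul (wr i) (Δr i) (𝒟r i) s t‖ := norm_add_le _ _
      _ ≤ e i s t + R * (∑ u, wr i u) * esup (𝒟r i) := by linarith
  have hc : ∀ i < n, ∀ s, ‖cr i s‖ ≤ Us i * (∑ u, wr i u) * R := by
    intro i hi s
    have h1 : ‖∑ u, Δr i s u * (wr i u : ℂ)‖ ≤ (∑ u, wr i u) * esup (Δr i) :=
      norm_sum_mul_le (hwr0 i) fun u => le_esup (Δr i) s u
    calc ‖cr i s‖ = Us i * ‖∑ u, Δr i s u * (wr i u : ℂ)‖ := by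
          simp only [hcr, norm_mul, Complex.norm_real, Real.norm_eq_abs, abs_of_nonneg (hUs_nonneg i)]
      _ ≤ Us i * ((∑ u, wr i u) * R) :=
          mul_le_mul_of_nonneg_left (h1.trans (mul_le_mul_of_nonneg_left (hΔr_sup i hi) (hWr0 i))) (hUs_nonneg i)
      _ = Us i * (∑ u, wr i u) * R := by ring
  have ha : ∀ s t : ↥B, ‖𝒞r 0 s t - ((Us 0 : ℝ) : ℂ)‖ + ∑ j ∈ range n, e j s t ≤ A := by
    intro s t
    have h0' : ‖𝒞r 0 s t - ((Us 0 : ℝ) : ℂ)‖ ≤ initDevBar G U := by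
      rw [hUs0]
      have := h0 s.1 s.2 t.1 t.2
      simpa [h𝒞r, resArr, hC, klPairArray_apply_of_mem L M β U μ K 0 Qm s.2 t.2] using this
    have h1 : ∑ j ∈ range n, e j s t = Sτ + ∑ j ∈ range n, X (j + 1) s.1 t.1 := by
      simp only [he, hSτ, sum_add_distrib]
    have h2 := hXtot s.1 t.1
    rw [h1, hA]
    linarith
  have hsmall' : 8 * 20 * (A + R) * ∑ j ∈ range n, (∑ u, wr j u) ≤ 1 := by
    refine le_trans ?_ hsmall
    have hW : ∑ j ∈ range n, (∑ u, wr j u) ≤ G.bhi * n := by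
      calc ∑ j ∈ range n, (∑ u, wr j u) ≤ ∑ j ∈ range n, G.bhi := sum_le_sum fun j hj => hWr j (mem_range.1 hj)
        _ = G.bhi * n := by rw [sum_const, card_range, nsmul_eq_mul, mul_comm]
    have : 8 * 20 * (A + R) * ∑ j ∈ range n, (∑ u, wr j u) ≤ 8 * 20 * (A + R) * (G.bhi * n) :=
      mul_le_mul_of_nonneg_left hW (by positivity)
    refine this.trans (le_of_eq ?_)
    simp only [hA, hR, hSτ, hτ]
  -- the cascade lemma
  have hmain := sWaveCascade_envelope_sources (w := wr) hwr0 (𝒞 := 𝒞r) (E := Er) (c := cr) (e := e) (U := Us) (N := n)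
    (a := A) (r := R) hUs0' hUss hstep' he0 hE hA0 ha hR0 hc hsmall'
  obtain ⟨⟨hUn0, hUnU⟩, hdev⟩ := hmain n le_rfl
  refine ⟨Us n, hUn0, by rw [hUs0] at hUnU; exact hUnU, fun k hk k' hk' => ?_⟩
  have hent := le_esup (𝒞r n - ((Us n : ℝ) : ℂ) • onesArr) ⟨k, hk⟩ ⟨k', hk'⟩
  have heq : (𝒞r n - ((Us n : ℝ) : ℂ) • onesArr : ↥B → ↥B → ℂ) ⟨k, hk⟩ ⟨k', hk'⟩ =
      klPairAmplitude L M β U μ K n Qm k k' - ((Us n : ℝ) : ℂ) := by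
    have h1 : 𝒞r n ⟨k, hk⟩ ⟨k', hk'⟩ = klPairAmplitude L M β U μ K n Qm k k' := by
      simp only [h𝒞r, resArr, hC]
      exact klPairArray_apply_of_mem L M β U μ K n Qm hk hk'
    simp only [Pi.sub_apply, Pi.smul_apply, smul_eq_mul, onesArr, mul_one, h1]
  rw [heq] at hent
  refine hent.trans (hdev.trans (le_of_eq ?_))
  simp only [hA, hR, hSτ, hτ]


end Model

end Summit.HubbardSuperconductivity.HubbardSuperconductivity.Theorems.KLRegimeSplit

end
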